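import Summits.AtomisticToContinuum.BoseEinsteinCondensation.Theses.BECRichardsonGaudin
import Summits.AtomisticToContinuum.BoseEinsteinCondensation.Theorems.BECRichardsonGaudinBeliaevDeformationBoundGappedAnchorComparison
import Summits.AtomisticToContinuum.BoseEinsteinCondensation.Theorems.BECRichardsonGaudinRichardsonAnchorBEC

/-!
# Skeleton v4 (lead c1, 2026-08-17) — crux `BeliaevDeformationBound`
(route `BECRichardsonGaudin`, item `stmt-AtomisticToContinuum-14804`, line `registered` = `Lines/birth.lean`)

THE CRUX (verbatim the route decl
`Summit.AtomisticToContinuum.BoseEinsteinCondensation.Theses.BECRichardsonGaudin.BeliaevDeformationBound`):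
for every soft (`∫v < ∞`) repulsive finite-range `v`, every `Λ > 0`, `ε > 0`, at all small `ρ` and
eventually in `N = n + 2` (`L = (N/ρ)^{1/3}`, `γ = ∫v`): every `δ`-near-minimiser `Ψ` of the periodic
energy admits a `δ'`-near-minimiser `Φ` of Richardson's matched anchor functional
`E_anc = K + 2ργ·(N − n₀) + (reduced band-limited pairing term)` with `n₀(Φ) ≤ n₀(Ψ) + εN`.
Write `Cmp(X, Y; ε)` for this comparison shape; the crux body is `Cmp(E_gas, E_anc; ε)`.

## The line (birth): factor through the SHIFTED GAS `E_pen = periodicEnergy v + 2ργ·(N − n₀)`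
into the INFRARED leg A `stub_shiftRemoval : Cmp(E_gas, E_pen; ε)` and the GAPPED leg B
`Cmp(E_pen, E_anc; ε)`, composed by transitivity (`ε/2 + ε/2`).

## History
* v1 (planner birth): stubs A, B.  * v2 (lead 0, reshape r1): B cut into B1a `stub_jastrowDepletion`,
  B1b `stub_jastrowEnergy`, B1c `stub_condensedTrialState`, B2 `stub_penalisedCondensation`,
  B3 `stub_comparisonOfCondensation`.  * v3 (lead 0): ALL OF LEG B LANDED — B3 p147698, B1a p165847,
  B1b p165818, B1c p166110, B2 p165911 — and the ASSEMBLY p166461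
  (`Theorems/BECRichardsonGaudinBeliaevDeformationBoundGappedAnchorComparison.lean`:
  `gappedAnchorComparison` = leg B as a closed theorem, `beliaevDeformationBound_of_shiftRemoval` =
  A (let-free) → crux BY NAME); crux CLOSED MODULO A.
* v4 (this file, lead c1): A is now registered LET-FREE (its statement is literally the hypothesis of
  the landed `beliaevDeformationBound_of_shiftRemoval`; v3's registry entry was the `let`-form, whose
  one-line signature was truncated at `let N : ℕ`), the composition is the landed assembly theorem, and
  §4 records — sorry-free, from landed theorems only — WHAT A IS:
  `stub_shiftRemoval ⇔ crux ⇔ CompleteCondensation` (complete BEC of the soft periodic dilute gas in the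
  thermodynamic limit: the open problem of the summit conjunct in its strong form, LSSY2005 Ch. 5).

LAYOUT: §1 statements as `def … : Prop`; §2 the REGISTERED sorried stub `theorem stub_shiftRemoval`
(statement verbatim, fully explicit) and its name-keyed alias; §3 the sorry-free composition
`BeliaevDeformationBound_of`; §4 the equivalences.

References: LSSY2005 Thm 2.2, Thm 2.4, §1.2 (1.17)–(1.19), Ch. 5 (5.17); Fournais 2020 (1.1)–(1.5); the
line card `Lines/birth.md`; lead-0 report `LeadReport.md`.
-/

namespace Summit.AtomisticToContinuum.BoseEinsteinCondensation.Cruxes.BeliaevDeformationBound.Birth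

open scoped ENNReal
open MeasureTheory Filter
open Literature.MathematicalPhysics.QuantumManyBody.BoseGas
open Summit.AtomisticToContinuum.BoseEinsteinCondensation.Theses.BECRichardsonGaudin (BeliaevDeformationBound
  RichardsonAnchorBEC)
open Summit.AtomisticToContinuum.BoseEinsteinCondensation.Theorems.BeliaevDeformationBound
  (beliaevDeformationBound_of_shiftRemoval beliaevDeformationBound_of_completeCondensation
    completeCondensation_of_anchor_of_comparison stub_comparisonOfCondensation)
open Summit.AtomisticToContinuum.BoseEinsteinCondensation.Cruxes.RichardsonAnchorBEC.Birth (RichardsonAnchorBEC_proof)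

noncomputable section

/-! ## §1 The statements of the line -/

/-- Statement A — INFRARED LEG / SHIFT REMOVAL `Cmp(E_gas, E_pen; ε)`, LET-FREE (explicit) form: for
every soft repulsive finite-range `v` and `ε > 0`, at small `ρ`, eventually in `N = n + 2`: for every
`δ' > 0` there is `δ > 0` such that every `δ`-near-minimiser `Ψ` of the periodic energy admits a
`δ'`-near-minimiser `Φ` of the SHIFTED energy `E_pen = periodicEnergy v + 2ρ(∫v)·(N − n₀)` with
`n₀(Φ) ≤ n₀(Ψ) + εN`. In substance: complete BEC of the soft periodic gas (open problem, §4). -/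
def ShiftRemoval : Prop :=
  ∀ (v : ℝ → ENNReal) (ε : ℝ), IsRepulsiveFiniteRange v → (∫⁻ x : EuclideanSpace ℝ (Fin 3), v ‖x‖) ≠ ⊤ →
    0 < ε → ∃ ρ₀ : ℝ, 0 < ρ₀ ∧ ∀ ρ : ℝ, 0 < ρ → ρ < ρ₀ → ∀ᶠ n : ℕ in Filter.atTop,
      ∀ δ' : ENNReal, 0 < δ' → ∃ δ : ENNReal, 0 < δ ∧ ∀ Ψ : PeriodicTrialState (n + 2) (sideLength ρ (n + 2)),
        periodicEnergy v Ψ ≤ periodicGroundStateEnergy v (n + 2) (sideLength ρ (n + 2)) + δ →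
          ∃ Φ : PeriodicTrialState (n + 2) (sideLength ρ (n + 2)),
            periodicEnergy v Φ + ENNReal.ofReal (2 * ρ * (∫⁻ x : EuclideanSpace ℝ (Fin 3), v ‖x‖).toReal) *
                (((n + 2 : ℕ) : ENNReal) - condensateOccupation (n + 2) (sideLength ρ (n + 2)) Φ.ψ) ≤
              (⨅ Φ' : PeriodicTrialState (n + 2) (sideLength ρ (n + 2)),
                (periodicEnergy v Φ' + ENNReal.ofReal (2 * ρ * (∫⁻ x : EuclideanSpace ℝ (Fin 3), v ‖x‖).toReal) *
                  (((n + 2 : ℕ) : ENNReal) - condensateOccupation (n + 2) (sideLength ρ (n + 2)) Φ'.ψ))) + δ' ∧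
            condensateOccupation (n + 2) (sideLength ρ (n + 2)) Φ.ψ ≤
              condensateOccupation (n + 2) (sideLength ρ (n + 2)) Ψ.ψ + ENNReal.ofReal (ε * ((n + 2 : ℕ) : ℝ))

/-- COMPLETE CONDENSATION of the soft periodic dilute gas (thermodynamic limit at fixed small `ρ`; the
torus of side `sideLength ρ N = (N/ρ)^{1/3}`): for every `ε > 0`, at small `ρ`, eventually in `N`, the
`δ`-near-minimisers of `periodicEnergy v` have `n₀ ≥ (1 − ε)N`. The open problem (LSSY2005 Ch. 5);
consumed only as one side of the equivalences of §4. Indexed by `N` (the hypothesis shape of the landed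
`beliaevDeformationBound_of_completeCondensation`). -/
def CompleteCondensation : Prop :=
  ∀ v : ℝ → ℝ≥0∞, IsRepulsiveFiniteRange v → (∫⁻ x : Space, v ‖x‖) ≠ ⊤ →
    ∀ ε : ℝ, 0 < ε → ∃ ρ₀ : ℝ, 0 < ρ₀ ∧ ∀ ρ : ℝ, 0 < ρ → ρ < ρ₀ → ∀ᶠ N : ℕ in atTop,
      ∃ δ : ℝ≥0∞, 0 < δ ∧ ∀ Ψ : PeriodicTrialState N (sideLength ρ N),
        periodicEnergy v Ψ ≤ periodicGroundStateEnergy v N (sideLength ρ N) + δ →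
          ENNReal.ofReal ((1 - ε) * N) ≤ condensateOccupation N (sideLength ρ N) Ψ.ψ

/-! ## §2 The registered stub (sorried theorem, statement verbatim and fully explicit) and its alias -/

/-- stub A — INFRARED LEG / SHIFT REMOVAL, let-free (size XL; open-problem: by §4 it is EQUIVALENT to
the crux and to `CompleteCondensation`; held by the lead). -/
theorem stub_shiftRemoval :
  ∀ (v : ℝ → ENNReal) (ε : ℝ), IsRepulsiveFiniteRange v → (∫⁻ x : EuclideanSpace ℝ (Fin 3), v ‖x‖) ≠ ⊤ →
    0 < ε → ∃ ρ₀ : ℝ, 0 < ρ₀ ∧ ∀ ρ : ℝ, 0 < ρ → ρ < ρ₀ → ∀ᶠ n : ℕ in Filter.atTop,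
      ∀ δ' : ENNReal, 0 < δ' → ∃ δ : ENNReal, 0 < δ ∧ ∀ Ψ : PeriodicTrialState (n + 2) (sideLength ρ (n + 2)),
        periodicEnergy v Ψ ≤ periodicGroundStateEnergy v (n + 2) (sideLength ρ (n + 2)) + δ →
          ∃ Φ : PeriodicTrialState (n + 2) (sideLength ρ (n + 2)),
            periodicEnergy v Φ + ENNReal.ofReal (2 * ρ * (∫⁻ x : EuclideanSpace ℝ (Fin 3), v ‖x‖).toReal) *
                (((n + 2 : ℕ) : ENNReal) - condensateOccupation (n + 2) (sideLength ρ (n + 2)) Φ.ψ) ≤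
              (⨅ Φ' : PeriodicTrialState (n + 2) (sideLength ρ (n + 2)),
                (periodicEnergy v Φ' + ENNReal.ofReal (2 * ρ * (∫⁻ x : EuclideanSpace ℝ (Fin 3), v ‖x‖).toReal) *
                  (((n + 2 : ℕ) : ENNReal) - condensateOccupation (n + 2) (sideLength ρ (n + 2)) Φ'.ψ))) + δ' ∧
            condensateOccupation (n + 2) (sideLength ρ (n + 2)) Φ.ψ ≤
              condensateOccupation (n + 2) (sideLength ρ (n + 2)) Ψ.ψ + ENNReal.ofReal (ε * ((n + 2 : ℕ) : ℝ)) := by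
  sorry

namespace __Registered

/-- alias of `ShiftRemoval` = the statement of `stub_shiftRemoval`. -/
abbrev stub_shiftRemoval : Prop := ShiftRemoval

end __Registered

/-- consistency: the registered stub proves its named statement (types agree by `rfl`). -/
example : __Registered.stub_shiftRemoval := stub_shiftRemoval

/-! ## §3 Composition (sorry-free): the landed assembly theorem -/

/-- ASSEMBLY: the one registered stub (A) gives the crux BY NAME — leg B is discharged inside the landed
`beliaevDeformationBound_of_shiftRemoval` (p166461: `gappedAnchorComparison` from B1a–B3, then
transitivity of `Cmp` with `ε/2 + ε/2` and the `δ`-bookkeeping run backwards). -/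
theorem BeliaevDeformationBound_of (hA : __Registered.stub_shiftRemoval) :
    Summit.AtomisticToContinuum.BoseEinsteinCondensation.Theses.BECRichardsonGaudin.BeliaevDeformationBound :=
  beliaevDeformationBound_of_shiftRemoval hA

/-! ## §4 What A is (sorry-free, landed theorems only): `stub_shiftRemoval ⇔ crux ⇔ CompleteCondensation` -/

/-- Index shift for the thermodynamic-limit filter: a property holding eventually in `n` for `N = n + 2`
holds eventually in `N`. [folklore] -/
theorem eventually_atTop_of_add_two {P : ℕ → Prop} (h : ∀ᶠ n : ℕ in atTop, P (n + 2)) :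
    ∀ᶠ N : ℕ in atTop, P N := by
  rw [Filter.eventually_atTop] at h ⊢
  obtain ⟨n₀, hn₀⟩ := h
  refine ⟨n₀ + 2, fun N hN => ?_⟩
  obtain ⟨n, rfl⟩ : ∃ n, N = n + 2 := ⟨N - 2, by omega⟩
  exact hn₀ n (by omega)

/-- THE CRUX IS COMPLETE CONDENSATION: `BeliaevDeformationBound ↔ CompleteCondensation`.
(→) ranks 2 + 3 give complete BEC (`completeCondensation_of_anchor_of_comparison`, landed p165778) and
rank 3 is a theorem (`RichardsonAnchorBEC_proof`); (←) the sandwich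
`beliaevDeformationBound_of_completeCondensation` (landed p147698). [folklore] -/
theorem beliaevDeformationBound_iff_completeCondensation :
    BeliaevDeformationBound ↔ CompleteCondensation := by
  refine ⟨fun hB v hv hint ε hε => ?_, fun h => beliaevDeformationBound_of_completeCondensation h⟩
  obtain ⟨ρ₀, hρ₀, H⟩ :=
    completeCondensation_of_anchor_of_comparison RichardsonAnchorBEC_proof hB v hv hint ε hε
  exact ⟨ρ₀, hρ₀, fun ρ hρ hρlt => eventually_atTop_of_add_two
    (P := fun N => ∃ δ : ℝ≥0∞, 0 < δ ∧ ∀ Ψ : PeriodicTrialState N (sideLength ρ N),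
      periodicEnergy v Ψ ≤ periodicGroundStateEnergy v N (sideLength ρ N) + δ →
        ENNReal.ofReal ((1 - ε) * N) ≤ condensateOccupation N (sideLength ρ N) Ψ.ψ) (H ρ hρ hρlt)⟩

/-- A ⇐ complete condensation (the sandwich B3 = `stub_comparisonOfCondensation`, landed p147698, with
`X := periodicEnergy v`, `E := E_pen`). [folklore] -/
theorem shiftRemoval_of_completeCondensation (h : CompleteCondensation) : ShiftRemoval := by
  intro v ε hv hint hε
  obtain ⟨ρ₀, hρ₀, H⟩ := h v hv hint ε hε
  refine ⟨ρ₀, hρ₀, fun ρ hρ hρlt => ?_⟩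
  filter_upwards [(tendsto_add_atTop_nat 2).eventually (H ρ hρ hρlt)] with n hn
  have hL : 0 < sideLength ρ (n + 2) := by
    unfold sideLength
    exact Real.rpow_pos_of_pos (div_pos (by exact_mod_cast Nat.succ_pos _) hρ) _
  exact stub_comparisonOfCondensation (n + 2) (sideLength ρ (n + 2)) ε hL (fun Ψ => periodicEnergy v Ψ) _ hn

/-- THE STUB IS THE CRUX: `stub_shiftRemoval ⇔ BeliaevDeformationBound` — (→) is the landed assembly,
(←) goes through complete condensation. So A is not a proper part of the crux: it is the crux, and both
are complete BEC of the soft gas (`shiftRemoval_iff_completeCondensation`). [folklore] -/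
theorem shiftRemoval_iff_beliaevDeformationBound : ShiftRemoval ↔ BeliaevDeformationBound :=
  ⟨fun hA => beliaevDeformationBound_of_shiftRemoval hA, fun hB =>
    shiftRemoval_of_completeCondensation (beliaevDeformationBound_iff_completeCondensation.mp hB)⟩

/-- A ⇔ complete condensation of the soft periodic gas. [folklore] -/
theorem shiftRemoval_iff_completeCondensation : ShiftRemoval ↔ CompleteCondensation :=
  shiftRemoval_iff_beliaevDeformationBound.trans beliaevDeformationBound_iff_completeCondensation

/-- Sanity (not a declaration): the registered stub's statement is literally the hypothesis of
`BeliaevDeformationBound_of`, so this term closes the crux the day `stub_shiftRemoval` is a theorem. -/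
example : Summit.AtomisticToContinuum.BoseEinsteinCondensation.Theses.BECRichardsonGaudin.BeliaevDeformationBound :=
  BeliaevDeformationBound_of stub_shiftRemoval

end

end Summit.AtomisticToContinuum.BoseEinsteinCondensation.Cruxes.BeliaevDeformationBound.Birth
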